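import Summits.ResolutionOfSingularities.ResolutionOfSingularities.Theorems.FrobeniusClosingSteerSeqDirectLimit
import Summits.ResolutionOfSingularities.ResolutionOfSingularities.Theorems.FrobeniusClosingSteerEtaleTowerLevels
import HarnessLib

/-!
# [OURS · L0 W4.1] K3ᴳ (F4): the étale tower READ IN ONE FIELD — `L′ := Frac (lim Tₘ)`, the lifted chain `S′ m := range (Tₘ → L′)`, `LevelLift` at every
# level, squares, dominance, and residual RATIONALITY below the horizon
# (chain W4.1 `FrobeniusClosingSteer`, crux stmt-ResolutionOfSingularities-16345; K3ᴳ = `K3GTarget.horizonBaseChange`, res-L0-w41-stub-2 signature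
# 8151858124874f54; `--supports … --as helper`)

HONEST FRAMING. OURS kernel (HIRONAKA-L librarian res-D-lib-1 gen 8). The ℕ-indexed analogue of `EtaleLift.exists_rational_window_lift`: the injective local
maps `gₘ : Tₘ → Tₘ₊₁` of `…EtaleTowerLevels` (regular members) have a DOMAIN as sequential direct limit (`…SeqDirectLimit`), and inside `L′ := Frac (lim Tₘ)`
the ranges `S′ m` of the injective `jₘ : Tₘ → L′` form a chain with `EtaleLift.LevelLift (S m) (S′ m) (jₘ ∘ (S m → Tₘ)) θ′` at EVERY level
(`EtaleLift.levelLift_range`), commuting squares, dominance, and — given that every residue below level `M` is a polynomial in `θ` with coefficients from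
`S 0` — residual rationality of `S′ m ≤ S′ (m+1)` for `m < M` (`EtaleLift.exists_sub_mem_maximalIdeal_of_coeff` + `isResiduallyRational_range`).
* `exists_chain_lift` — the packaged ∃-statement consumed by the K3ᴳ assembly.
Nothing here is a statement of H. Hironaka's manuscript [Hironaka2017]. AI-written; AI review is weaker than expert review. [folklore]
-/

set_option linter.dupNamespace false

noncomputable section

namespace Summit.ResolutionOfSingularities.ResolutionOfSingularities.Theorems.SwitchingDichotomy.EtaleTower

open IsLocalRing Polynomial Literature.AlgebraicGeometry.Resolution
open Summit.ResolutionOfSingularities.ResolutionOfSingularities.Theorems.SwitchingDichotomy.EtaleLift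

variable {L : Type} [Field L] (S : ℕ → Subring L) [∀ m, IsLocalRing (S m)] (hdom : ∀ m, SubringDominates (S m) (S (m + 1)))
  (P : (S 0)[X]) {k' : Type} [Field k'] (ψ : ∀ m, ResidueField (S m) →+* k') (hψ : IsCompat S hdom ψ) (θ : k')
  (hθ₀ : P.eval₂ ((ψ 0).comp (residue (S 0))) θ = 0)

/-! ## §1 One step of residual rationality inside the tower -/

/-- **Residual rationality of one step of the tower** `Tₘ → Tₘ₊₁`, from: every residue of `S (m+1)` is a polynomial in `θ` with coefficients from `S 0`.
[folklore] -/
theorem exists_sub_gT_mem (hP : P.Monic) (m : ℕ)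
    (hcoeff : ∀ c : S (m + 1), ∃ q : (S 0)[X], ψ (m + 1) (residue (S (m + 1)) c) = q.eval₂ ((ψ 0).comp (residue (S 0))) θ)
    (t : Localization.AtPrime (kerT S hdom P ψ hψ θ hθ₀ (m + 1))) :
    ∃ t₀ : Localization.AtPrime (kerT S hdom P ψ hψ θ hθ₀ m), t - gT S hdom P ψ hψ θ hθ₀ m t₀ ∈ maximalIdeal _ := by
  haveI := isLocalHom_inclusion_of_subringDominates (hdom m)
  haveI := isMaximal_kerT S hdom P ψ hψ θ hθ₀ hP (m + 1)
  -- the inclusion `S 0 → S m`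
  let i₀ : S 0 →+* S m := Subring.inclusion (monotone_nat_of_le_succ (fun m => (hdom m).1) (Nat.zero_le m))
  have hcoeff' : ∀ c : S (m + 1), ∃ a₀ : AdjoinRoot (Ptower S hdom P m),
      AdjoinRoot.of (Ptower S hdom P (m + 1)) c - ιT S hdom P m a₀ ∈ kerT S hdom P ψ hψ θ hθ₀ (m + 1) := by
    intro c
    obtain ⟨q, hq⟩ := hcoeff c
    refine ⟨AdjoinRoot.mk (Ptower S hdom P m) (q.map i₀), ?_⟩
    rw [RingHom.mem_ker, map_sub, sub_eq_zero, AdjoinRoot.lift_of, lift_ιT_mk S hdom P ψ hψ θ hθ₀ m (q.map i₀), Polynomial.eval₂_map]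
    have hfun : (((ψ (m + 1)).comp (ResidueField.map (Subring.inclusion (hdom m).1))).comp (residue (S m))).comp i₀ =
        (ψ 0).comp (residue (S 0)) := by
      ext s
      have h := residue_inclusion_eq S hdom ψ hψ (Nat.zero_le (m + 1)) s
      simp only [RingHom.comp_apply, ResidueField.map_residue]
      exact h
    rw [hfun, ← hq]
    rfl
  have hroot' : ∃ a₀ : AdjoinRoot (Ptower S hdom P m),
      AdjoinRoot.root (Ptower S hdom P (m + 1)) - ιT S hdom P m a₀ ∈ kerT S hdom P ψ hψ θ hθ₀ (m + 1) :=
    ⟨AdjoinRoot.root (Ptower S hdom P m), by rw [ιT_root, sub_self]; exact Ideal.zero_mem _⟩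
  obtain ⟨a₀, ha₀⟩ := exists_sub_mem_maximalIdeal_of_coeff (Ptower S hdom P (m + 1)) (ιT S hdom P m) _ hcoeff' hroot' t
  refine ⟨algebraMap (AdjoinRoot (Ptower S hdom P m)) _ a₀, ?_⟩
  have hga : gT S hdom P ψ hψ θ hθ₀ m (algebraMap (AdjoinRoot (Ptower S hdom P m)) _ a₀) =
      algebraMap (AdjoinRoot (Ptower S hdom P (m + 1))) _ (ιT S hdom P m a₀) :=
    RingHom.congr_fun (gT_comp S hdom P ψ hψ θ hθ₀ m) a₀
  rw [hga]
  exact ha₀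

/-! ## §2 The tower read through a compatible family of embeddings `jₘ : Tₘ → L′` into a field -/

section Embeddings

variable {L' : Type} [Field L'] (j : ∀ m, Localization.AtPrime (kerT S hdom P ψ hψ θ hθ₀ m) →+* L')
  (hjsucc : ∀ m, (j (m + 1)).comp (gT S hdom P ψ hψ θ hθ₀ m) = j m)

include hjsucc

/-- `jₘ₊₁ (gₘ t) = jₘ t`. [folklore] -/
theorem j_gT (m : ℕ) (t : Localization.AtPrime (kerT S hdom P ψ hψ θ hθ₀ m)) : j (m + 1) (gT S hdom P ψ hψ θ hθ₀ m t) = j m t :=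
  RingHom.congr_fun (hjsucc m) t

/-- The root read in `L′` is the same at every level. [folklore] -/
theorem j_root (m : ℕ) :
    j m (algebraMap (AdjoinRoot (Ptower S hdom P m)) _ (AdjoinRoot.root (Ptower S hdom P m))) =
      j 0 (algebraMap (AdjoinRoot (Ptower S hdom P 0)) _ (AdjoinRoot.root (Ptower S hdom P 0))) := by
  induction m with
  | zero => rfl
  | succ m ih => rw [← ih, ← j_gT S hdom P ψ hψ θ hθ₀ j hjsucc m, gT_root]

/-- The squares: `jₘ₊₁ (incl s) = jₘ (s)`. [folklore] -/
theorem j_algebraMap_inclusion (m : ℕ) (s : S m) :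
    j (m + 1) (algebraMap (S (m + 1)) _ (Subring.inclusion (hdom m).1 s)) = j m (algebraMap (S m) _ s) := by
  rw [← j_gT S hdom P ψ hψ θ hθ₀ j hjsucc m, gT_algebraMap]

/-- `range jₘ ≤ range jₘ₊₁`. [folklore] -/
theorem range_j_le (m : ℕ) : (j m).range ≤ (j (m + 1)).range := by
  have h := range_comp_le (gT S hdom P ψ hψ θ hθ₀ m) (j (m + 1))
  rwa [hjsucc m] at h

/-- **Dominance upstairs**: `range jₘ ≺ range jₘ₊₁` (injective `jₘ₊₁`). [folklore] -/
theorem dominates_range_j (hj : ∀ m, Function.Injective (j m)) (m : ℕ) : SubringDominates (j m).range (j (m + 1)).range := by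
  have h := subringDominates_range_comp (gT S hdom P ψ hψ θ hθ₀ m) (j (m + 1)) (hj (m + 1))
  rwa [hjsucc m] at h

/-- **`LevelLift` at every level** of the tower, with the common root `θ′ := j₀ (x₀)` (regular members, injective `jₘ`). [cite: StacksProject, Tag 00TV] -/
theorem levelLift_j (hreg : ∀ m, IsRegularLocalRing (S m)) (hP : P.Monic) (hsep : (P.map (residue (S 0))).Separable)
    (hj : ∀ m, Function.Injective (j m)) (m : ℕ) :
    haveI := isLocalRing_range (j m)
    LevelLift (S m) (j m).range ((j m).rangeRestrict.comp (algebraMap (S m) _))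
      (j 0 (algebraMap (AdjoinRoot (Ptower S hdom P 0)) _ (AdjoinRoot.root (Ptower S hdom P 0)))) := by
  haveI := hreg m
  have h := levelLift_range (Ptower S hdom P m) (ψ m) θ (eval₂_Ptower S hdom P ψ hψ θ hθ₀ m) (monic_Ptower S hdom P hP m)
    (separable_Ptower S hdom P hsep m) (j m) (hj m)
  rw [j_root S hdom P ψ hψ θ hθ₀ j hjsucc m] at h
  exact h

/-- **Residual rationality upstairs** at a step `m` below the horizon (injective `jₘ₊₁`). [folklore] -/
theorem isResiduallyRational_range_j (hP : P.Monic) (hj : ∀ m, Function.Injective (j m)) (m : ℕ)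
    (hcoeff : ∀ c : S (m + 1), ∃ q : (S 0)[X], ψ (m + 1) (residue (S (m + 1)) c) = q.eval₂ ((ψ 0).comp (residue (S 0))) θ) :
    haveI := isLocalRing_range (j m)
    haveI := isLocalRing_range (j (m + 1))
    IsResiduallyRational (j m).range (j (m + 1)).range (range_j_le S hdom P ψ hψ θ hθ₀ j hjsucc m) := by
  haveI := isLocalRing_range (j m)
  haveI := isLocalRing_range (j (m + 1))
  haveI := isLocalRing_range ((j (m + 1)).comp (gT S hdom P ψ hψ θ hθ₀ m))
  intro z
  obtain ⟨s, hs⟩ := isResiduallyRational_range (gT S hdom P ψ hψ θ hθ₀ m) (j (m + 1)) (hj (m + 1))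
    (exists_sub_gT_mem S hdom P ψ hψ θ hθ₀ hP m hcoeff) (range_comp_le _ _) z
  have hs' : (s : L') ∈ (j m).range := by
    obtain ⟨t, ht⟩ := s.2
    exact ⟨t, by rw [← ht]; exact (j_gT S hdom P ψ hψ θ hθ₀ j hjsucc m t).symm⟩
  exact ⟨⟨(s : L'), hs'⟩, hs⟩

end Embeddings

/-! ## §3 The limit field `L′ := Frac (lim Tₘ)` and the chain lift -/

/-- `lim Tₘ`, the sequential direct limit of the tower along the `gₘ` (`…SeqDirectLimit`). [invented: ours] -/
abbrev LimT : Type :=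
  SeqLimit.Limit (T := fun m => Localization.AtPrime (kerT S hdom P ψ hψ θ hθ₀ m)) (gT S hdom P ψ hψ θ hθ₀)

/-- **`jₘ : Tₘ → Frac (lim Tₘ)`.** [invented: ours] -/
abbrev jT (m : ℕ) : Localization.AtPrime (kerT S hdom P ψ hψ θ hθ₀ m) →+* FractionRing (LimT S hdom P ψ hψ θ hθ₀) :=
  (algebraMap (LimT S hdom P ψ hψ θ hθ₀) (FractionRing (LimT S hdom P ψ hψ θ hθ₀))).comp
    (SeqLimit.of (T := fun m => Localization.AtPrime (kerT S hdom P ψ hψ θ hθ₀ m)) (gT S hdom P ψ hψ θ hθ₀) m)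

/-- `jₘ₊₁ ∘ gₘ = jₘ`. [folklore] -/
theorem jT_comp_gT (m : ℕ) : (jT S hdom P ψ hψ θ hθ₀ (m + 1)).comp (gT S hdom P ψ hψ θ hθ₀ m) = jT S hdom P ψ hψ θ hθ₀ m := by
  refine RingHom.ext fun x => ?_
  exact congrArg (algebraMap (LimT S hdom P ψ hψ θ hθ₀) (FractionRing (LimT S hdom P ψ hψ θ hθ₀)))
    (SeqLimit.of_succ (T := fun m => Localization.AtPrime (kerT S hdom P ψ hψ θ hθ₀ m)) (gT S hdom P ψ hψ θ hθ₀) m x)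

/-- **`lim Tₘ` is a domain** (regular members). [folklore] -/
theorem isDomain_LimT (hreg : ∀ m, IsRegularLocalRing (S m)) (hP : P.Monic) (hsep : (P.map (residue (S 0))).Separable) :
    IsDomain (LimT S hdom P ψ hψ θ hθ₀) :=
  haveI : ∀ m, IsDomain (Localization.AtPrime (kerT S hdom P ψ hψ θ hθ₀ m)) := fun m => isDomain_T S hdom P ψ hψ θ hθ₀ hreg hP hsep m
  SeqLimit.isDomain_limit (T := fun m => Localization.AtPrime (kerT S hdom P ψ hψ θ hθ₀ m)) (gT S hdom P ψ hψ θ hθ₀)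
    (injective_gT S hdom P ψ hψ θ hθ₀ hreg hP hsep)

/-- **`jₘ` is injective** (regular members). [folklore] -/
theorem injective_jT (hreg : ∀ m, IsRegularLocalRing (S m)) (hP : P.Monic) (hsep : (P.map (residue (S 0))).Separable) (m : ℕ) :
    Function.Injective (jT S hdom P ψ hψ θ hθ₀ m) :=
  (IsFractionRing.injective (LimT S hdom P ψ hψ θ hθ₀) (FractionRing (LimT S hdom P ψ hψ θ hθ₀))).comp
    (SeqLimit.of_injective (T := fun m => Localization.AtPrime (kerT S hdom P ψ hψ θ hθ₀ m)) (gT S hdom P ψ hψ θ hθ₀)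
      (injective_gT S hdom P ψ hψ θ hθ₀ hreg hP hsep) m)

/-- **The CHAIN LIFT.** For a chain `S 0 ≺ S 1 ≺ ⋯ ⊆ L` of dominated regular local subrings, `P ∈ (S 0)[X]` monic with separable reduction, compatible
`ψ m : κ(S m) → k′` and a root `θ ∈ k′` of `P`, and a horizon `M` below which every residue is a polynomial in `θ` over `S 0`: a field `L′`, a chain of local
subrings `S′ m ⊆ L′`, an element `θ′ ∈ L′`, local maps `φ m : S m → S′ m` with `P(θ′) = 0` through `φ 0`, `LevelLift (S m) (S′ m) (φ m) θ′` for EVERY `m`,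
commuting squares, dominance `S′ m ≺ S′ (m+1)`, and residual rationality of `S′ m ≤ S′ (m+1)` for every `m < M`. [cite: StacksProject, Tag 00TV] -/
theorem exists_chain_lift (hψ : IsCompat S hdom ψ) (hθ₀ : P.eval₂ ((ψ 0).comp (residue (S 0))) θ = 0) (hreg : ∀ m, IsRegularLocalRing (S m)) (hP : P.Monic) (hsep : (P.map (residue (S 0))).Separable) (M : ℕ)
    (hcoeff : ∀ m, m < M → ∀ c : S (m + 1), ∃ q : (S 0)[X], ψ (m + 1) (residue (S (m + 1)) c) = q.eval₂ ((ψ 0).comp (residue (S 0))) θ) :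
    ∃ (L' : Type) (_ : Field L') (S' : ℕ → Subring L') (_ : ∀ m, IsLocalRing (S' m)) (θ' : L')
      (φ : ∀ m, S m →+* S' m) (hle' : ∀ m, S' m ≤ S' (m + 1)),
      P.eval₂ ((S' 0).subtype.comp (φ 0)) θ' = 0 ∧
      (∀ m, LevelLift (S m) (S' m) (φ m) θ') ∧
      (∀ m (s : S m), ((φ (m + 1) (Subring.inclusion (hdom m).1 s) : S' (m + 1)) : L') = ((φ m s : S' m) : L')) ∧
      (∀ m, SubringDominates (S' m) (S' (m + 1))) ∧
      (∀ m, m < M → IsResiduallyRational (S' m) (S' (m + 1)) (hle' m)) := by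
  haveI := isDomain_LimT S hdom P ψ hψ θ hθ₀ hreg hP hsep
  have hj := injective_jT S hdom P ψ hψ θ hθ₀ hreg hP hsep
  have hjsucc := jT_comp_gT S hdom P ψ hψ θ hθ₀
  haveI hl : ∀ m, IsLocalRing (jT S hdom P ψ hψ θ hθ₀ m).range := fun m => isLocalRing_range _
  refine ⟨FractionRing (LimT S hdom P ψ hψ θ hθ₀), inferInstance, fun m => (jT S hdom P ψ hψ θ hθ₀ m).range, hl,
    jT S hdom P ψ hψ θ hθ₀ 0 (algebraMap (AdjoinRoot (Ptower S hdom P 0)) _ (AdjoinRoot.root (Ptower S hdom P 0))),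
    fun m => (jT S hdom P ψ hψ θ hθ₀ m).rangeRestrict.comp (algebraMap (S m) _),
    range_j_le S hdom P ψ hψ θ hθ₀ (jT S hdom P ψ hψ θ hθ₀) hjsucc, ?_,
    fun m => levelLift_j S hdom P ψ hψ θ hθ₀ (jT S hdom P ψ hψ θ hθ₀) hjsucc hreg hP hsep hj m,
    fun m s => j_algebraMap_inclusion S hdom P ψ hψ θ hθ₀ (jT S hdom P ψ hψ θ hθ₀) hjsucc m s,
    dominates_range_j S hdom P ψ hψ θ hθ₀ (jT S hdom P ψ hψ θ hθ₀) hjsucc hj,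
    fun m hm => isResiduallyRational_range_j S hdom P ψ hψ θ hθ₀ (jT S hdom P ψ hψ θ hθ₀) hjsucc hP hj m (hcoeff m hm)⟩
  -- the monic relation at level 0
  exact eval₂_rangeLift_root (Ptower S hdom P 0) (ψ 0) θ (eval₂_Ptower S hdom P ψ hψ θ hθ₀ 0) hP (jT S hdom P ψ hψ θ hθ₀ 0)

end Summit.ResolutionOfSingularities.ResolutionOfSingularities.Theorems.SwitchingDichotomy.EtaleTower

end
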